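import Summits.AtomisticToContinuum.Crystallization.Theorems.FrustratedLawDichotomyStrainedPatchHomLeafTableDataK4
import Summits.AtomisticToContinuum.Crystallization.Theorems.FrustratedLawDichotomyStrainedPatchHomLeafTableRowK
import Summits.AtomisticToContinuum.Crystallization.Theorems.FrustratedLawDichotomyStrainedPatchHomLeafTableTop

/-!
# v3 ("K") leaf checker — CERTIFICATION of the tier tables (kernel `decide`, chunk by chunk): tier 4 (ρ = 0.24): 517 rows

decomp-a2c hand-1 g22 (crux `AperiodicFrustratedLawGap`, stmt-AtomisticToContinuum-27623; critic rows 863/865 checker v3).  DEF-FREE.  Every chunk of ≤ 40 rows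
is ONE kernel evaluation of `QT.allOKK tabE 7` (≈ 0.22 s per row measured: value / derivative checks and the 8 curvature pieces of `Row.okK`); internal nodes are
assembled from their children's lemmas plus one row.  0 sorry; standard axioms.  `--supports stmt-AtomisticToContinuum-27623`.
-/

namespace Summit.AtomisticToContinuum.Crystallization.Theorems.FrustratedLawDichotomyStrainedPatchHomLeafTableCheck

/-- Rows 0–32 of tier 4 pass `Row.okK tabE 7`. [kernel computation] -/
theorem qk4_4_ok : QT.allOKK tabE 7 qk4_4 = true := by decide +kernel

/-- Rows 33–64 of tier 4 pass `Row.okK tabE 7`. [kernel computation] -/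
theorem qk4_5_ok : QT.allOKK tabE 7 qk4_5 = true := by decide +kernel

/-- Rows 0–64 of tier 4 pass `Row.okK tabE 7` (children + the node's row). [kernel computation] -/
theorem qk4_3_ok : QT.allOKK tabE 7 qk4_3 = true := by
  unfold qk4_3; simp only [QT.allOKK, qk4_4_ok, qk4_5_ok, Bool.true_and, Bool.and_true]; decide +kernel

/-- Rows 65–97 of tier 4 pass `Row.okK tabE 7`. [kernel computation] -/
theorem qk4_7_ok : QT.allOKK tabE 7 qk4_7 = true := by decide +kernel

/-- Rows 98–129 of tier 4 pass `Row.okK tabE 7`. [kernel computation] -/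
theorem qk4_8_ok : QT.allOKK tabE 7 qk4_8 = true := by decide +kernel

/-- Rows 65–129 of tier 4 pass `Row.okK tabE 7` (children + the node's row). [kernel computation] -/
theorem qk4_6_ok : QT.allOKK tabE 7 qk4_6 = true := by
  unfold qk4_6; simp only [QT.allOKK, qk4_7_ok, qk4_8_ok, Bool.true_and, Bool.and_true]; decide +kernel

/-- Rows 0–129 of tier 4 pass `Row.okK tabE 7` (children + the node's row). [kernel computation] -/
theorem qk4_2_ok : QT.allOKK tabE 7 qk4_2 = true := by
  unfold qk4_2; simp only [QT.allOKK, qk4_3_ok, qk4_6_ok, Bool.true_and, Bool.and_true]; decide +kernel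

/-- Rows 130–162 of tier 4 pass `Row.okK tabE 7`. [kernel computation] -/
theorem qk4_11_ok : QT.allOKK tabE 7 qk4_11 = true := by decide +kernel

/-- Rows 163–194 of tier 4 pass `Row.okK tabE 7`. [kernel computation] -/
theorem qk4_12_ok : QT.allOKK tabE 7 qk4_12 = true := by decide +kernel

/-- Rows 130–194 of tier 4 pass `Row.okK tabE 7` (children + the node's row). [kernel computation] -/
theorem qk4_10_ok : QT.allOKK tabE 7 qk4_10 = true := by
  unfold qk4_10; simp only [QT.allOKK, qk4_11_ok, qk4_12_ok, Bool.true_and, Bool.and_true]; decide +kernel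

/-- Rows 195–226 of tier 4 pass `Row.okK tabE 7`. [kernel computation] -/
theorem qk4_14_ok : QT.allOKK tabE 7 qk4_14 = true := by decide +kernel

/-- Rows 227–258 of tier 4 pass `Row.okK tabE 7`. [kernel computation] -/
theorem qk4_15_ok : QT.allOKK tabE 7 qk4_15 = true := by decide +kernel

/-- Rows 195–258 of tier 4 pass `Row.okK tabE 7` (children + the node's row). [kernel computation] -/
theorem qk4_13_ok : QT.allOKK tabE 7 qk4_13 = true := by
  unfold qk4_13; simp only [QT.allOKK, qk4_14_ok, qk4_15_ok, Bool.true_and, Bool.and_true]; decide +kernel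

/-- Rows 130–258 of tier 4 pass `Row.okK tabE 7` (children + the node's row). [kernel computation] -/
theorem qk4_9_ok : QT.allOKK tabE 7 qk4_9 = true := by
  unfold qk4_9; simp only [QT.allOKK, qk4_10_ok, qk4_13_ok, Bool.true_and, Bool.and_true]; decide +kernel

/-- Rows 0–258 of tier 4 pass `Row.okK tabE 7` (children + the node's row). [kernel computation] -/
theorem qk4_1_ok : QT.allOKK tabE 7 qk4_1 = true := by
  unfold qk4_1; simp only [QT.allOKK, qk4_2_ok, qk4_9_ok, Bool.true_and, Bool.and_true]; decide +kernel

/-- Rows 259–291 of tier 4 pass `Row.okK tabE 7`. [kernel computation] -/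
theorem qk4_19_ok : QT.allOKK tabE 7 qk4_19 = true := by decide +kernel

/-- Rows 292–323 of tier 4 pass `Row.okK tabE 7`. [kernel computation] -/
theorem qk4_20_ok : QT.allOKK tabE 7 qk4_20 = true := by decide +kernel

/-- Rows 259–323 of tier 4 pass `Row.okK tabE 7` (children + the node's row). [kernel computation] -/
theorem qk4_18_ok : QT.allOKK tabE 7 qk4_18 = true := by
  unfold qk4_18; simp only [QT.allOKK, qk4_19_ok, qk4_20_ok, Bool.true_and, Bool.and_true]; decide +kernel

/-- Rows 324–356 of tier 4 pass `Row.okK tabE 7`. [kernel computation] -/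
theorem qk4_22_ok : QT.allOKK tabE 7 qk4_22 = true := by decide +kernel

/-- Rows 357–388 of tier 4 pass `Row.okK tabE 7`. [kernel computation] -/
theorem qk4_23_ok : QT.allOKK tabE 7 qk4_23 = true := by decide +kernel

/-- Rows 324–388 of tier 4 pass `Row.okK tabE 7` (children + the node's row). [kernel computation] -/
theorem qk4_21_ok : QT.allOKK tabE 7 qk4_21 = true := by
  unfold qk4_21; simp only [QT.allOKK, qk4_22_ok, qk4_23_ok, Bool.true_and, Bool.and_true]; decide +kernel

/-- Rows 259–388 of tier 4 pass `Row.okK tabE 7` (children + the node's row). [kernel computation] -/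
theorem qk4_17_ok : QT.allOKK tabE 7 qk4_17 = true := by
  unfold qk4_17; simp only [QT.allOKK, qk4_18_ok, qk4_21_ok, Bool.true_and, Bool.and_true]; decide +kernel

/-- Rows 389–421 of tier 4 pass `Row.okK tabE 7`. [kernel computation] -/
theorem qk4_26_ok : QT.allOKK tabE 7 qk4_26 = true := by decide +kernel

/-- Rows 422–453 of tier 4 pass `Row.okK tabE 7`. [kernel computation] -/
theorem qk4_27_ok : QT.allOKK tabE 7 qk4_27 = true := by decide +kernel

/-- Rows 389–453 of tier 4 pass `Row.okK tabE 7` (children + the node's row). [kernel computation] -/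
theorem qk4_25_ok : QT.allOKK tabE 7 qk4_25 = true := by
  unfold qk4_25; simp only [QT.allOKK, qk4_26_ok, qk4_27_ok, Bool.true_and, Bool.and_true]; decide +kernel

/-- Rows 454–485 of tier 4 pass `Row.okK tabE 7`. [kernel computation] -/
theorem qk4_29_ok : QT.allOKK tabE 7 qk4_29 = true := by decide +kernel

/-- Rows 486–517 of tier 4 pass `Row.okK tabE 7`. [kernel computation] -/
theorem qk4_30_ok : QT.allOKK tabE 7 qk4_30 = true := by decide +kernel

/-- Rows 454–517 of tier 4 pass `Row.okK tabE 7` (children + the node's row). [kernel computation] -/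
theorem qk4_28_ok : QT.allOKK tabE 7 qk4_28 = true := by
  unfold qk4_28; simp only [QT.allOKK, qk4_29_ok, qk4_30_ok, Bool.true_and, Bool.and_true]; decide +kernel

/-- Rows 389–517 of tier 4 pass `Row.okK tabE 7` (children + the node's row). [kernel computation] -/
theorem qk4_24_ok : QT.allOKK tabE 7 qk4_24 = true := by
  unfold qk4_24; simp only [QT.allOKK, qk4_25_ok, qk4_28_ok, Bool.true_and, Bool.and_true]; decide +kernel

/-- Rows 259–517 of tier 4 pass `Row.okK tabE 7` (children + the node's row). [kernel computation] -/
theorem qk4_16_ok : QT.allOKK tabE 7 qk4_16 = true := by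
  unfold qk4_16; simp only [QT.allOKK, qk4_17_ok, qk4_24_ok, Bool.true_and, Bool.and_true]; decide +kernel

/-- Rows 0–517 of tier 4 pass `Row.okK tabE 7` (children + the node's row). [kernel computation] -/
theorem qk4_0_ok : QT.allOKK tabE 7 qk4_0 = true := by
  unfold qk4_0; simp only [QT.allOKK, qk4_1_ok, qk4_16_ok, Bool.true_and, Bool.and_true]; decide +kernel

/-- ★ Every row of the tier-4 table passes `Row.okK tabE 7`. [kernel computation] -/
theorem qTableK4_allOKK : QT.allOKK tabE 7 qTableK4 = true := qk4_0_ok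

end Summit.AtomisticToContinuum.Crystallization.Theorems.FrustratedLawDichotomyStrainedPatchHomLeafTableCheck
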